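import Literature.AnabelianGeometry.EtaleTheta.LogDivisorModelTateTowerThetaTwistLevel

/-!
# [EtTh] Def. 3.3 (iii) at a Kummer LEVEL of the `Ÿ`-skeleton: the FUNCTION-SIDE Kummer action `f_e ↦ ζ_m^{κ·e} f_e` of a class
# triple `κ = (κ_ϖ, κ_U, κ_Θ)` and its compatibility with the level transitions (Tate tower v3, piece 2b-ACTION-ARITH (1)+(3) — class (b))

S. Mochizuki, *The étale theta function …*, Publ. RIMS **45** (2009) [MochizukiEtTh2009], §1 p.13 («`K_N := K(ζ_N, q_X^{1/N})`»: the
Galois group of the Kummer coverings multiplies `N`-th roots by `N`-th roots of unity), Def. 3.3 (iii) p.73 (the action of `Π^tp_X` on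
`Mero(Z^log_∞)`), Prop. 1.4 p.21 [cite: MochizukiEtTh2009, Def 3.3 p.73].

CLASS (b) MODEL (abc-iut cell, layer L2; seat abc-iut-L2-t3 (gen 7), row «2b-ACTION-ARITH» items (1)+(3) of abc-iut-L2-lead R899;
items (2)/(4) — the interplay with the translation shear, `T_a K_κ T_a⁻¹ = K_{σ_a κ}` — are abc-iut-L1-t6's `thetaShear_pairing_shear` /
`pairing_shear_invariant_iff` (p481663) BY NAME, not re-derived; the knit `Grp′₃ →* Aut(level)` follows their `…CompatRShear`).  Over
this seat's level datum `TateTowerThetaTwist.model (Multiplicative B)` (p480037; `Fn = μ × (μ₂ × ⟨ϖ̈_m⟩ × ⟨Ü_m⟩ × ⟨Θ̈_m⟩)`, `μ := B`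
written multiplicatively, e.g. `B = ZMod (M m)`):
* `pairing κ f = c•κ_ϖ + k•κ_U + t•κ_Θ ∈ B` — the exponent of `ζ_m` by which the class triple `κ : Fin 3 → B` multiplies
  `ϖ̈_m^c Ü_m^k Θ̈_m^t` (bi-additive: `pairing_add`, `pairing_add_left`);
* **`kummerAut κ : Fn ≃* Fn`, `(ζ, f) ↦ (ζ · ζ_m^{κ·e(f)}, f)`** and **`kummerAction : Multiplicative (Fin 3 → B) →* MulAut Fn`** (a
  homomorphism in `κ`); it fixes the skeleton part, hence the divisor, the constants and the integral constants:
  **`kummerGaloisAction : (model (Multiplicative B)).GaloisAction (Multiplicative (Fin 3 → B))`** with TRIVIAL action on log-divisors,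
  cusps and components — every law PROVED («structure-preserving automorphisms of the level»); on the generators:
  `kummerAut_unif/coordU/theta` (`ϖ̈_m ↦ ζ^{κ_ϖ} ϖ̈_m`, `Ü_m ↦ ζ^{κ_U} Ü_m`, `Θ̈_m ↦ ζ^{κ_Θ} Θ̈_m`), `kummerAut_zeta` (roots of unity fixed);
* (3) the LEVEL TRANSITION `resFn ι e : Fn(μ) →* Fn(μ′)` along an inclusion of roots of unity `ι : B →+ B′` with ramification `e`
  (`(ζ, ϖ̈_m^c Ü_m^k Θ̈_m^t) ↦ (ι ζ, ϖ̈_{m′}^{ec} Ü_{m′}^{ek} Θ̈_{m′}^{et})`, the sign kept), its effect on divisors (`divFun_resExp`: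
  multiplication by `e`), and **`resFn_kummerAut`**: `res ∘ K_κ = K_{κ′} ∘ res` whenever `ι(κ_i) = e • κ′_i` (the classes of level
  `m` are the restrictions of those of level `m′`: `ζ_{m′}^{e} = ζ_m`).
HONEST LABEL: a combinatorial design model (the Kummer twist of the roots recorded at a level of the `Ÿ`-skeleton), NOT the tempered
fundamental group of a Tate curve; defs + theorems only, no Prop-valued fact, no instance, no notation, no sorry; nothing here bears
on [IUTchIII] Cor. 3.12; no side taken; typed ≠ proved.
-/

noncomputable section

namespace Literature.AnabelianGeometry.EtaleTheta

open CategoryTheory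

namespace LogDivisorModel

namespace TateTowerThetaTwist

open TateTowerTheta

variable {B : Type} [AddCommGroup B]

/-! ## The Kummer pairing of a class triple with the root exponents -/

/-- **`κ · e(f) = c•κ_ϖ + k•κ_U + t•κ_Θ ∈ μ`** (additively): the exponent of the root of unity by which the class triple `κ` multiplies
`(−1)^ε ϖ̈_m^c Ü_m^k Θ̈_m^t`. [cite: MochizukiEtTh2009, Def 3.3 p.73] -/
def pairing (κ : Fin 3 → B) (f : Exp) : B := eC f • κ 0 + eU f • κ 1 + eT f • κ 2

/-- The pairing is additive in the function. [cite: MochizukiEtTh2009, Def 3.3 p.73] -/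
theorem pairing_add (κ : Fin 3 → B) (f g : Exp) : pairing κ (f + g) = pairing κ f + pairing κ g := by
  simp only [pairing, eC_add, eU_add, eT_add, add_smul]
  abel

/-- The pairing with the trivial function vanishes. [cite: MochizukiEtTh2009, Def 3.3 p.73] -/
@[simp] theorem pairing_zero (κ : Fin 3 → B) : pairing κ 0 = 0 := by
  have h := pairing_add κ 0 0
  rw [add_zero] at h
  exact left_eq_add.mp h

/-- The pairing is additive in the class triple. [cite: MochizukiEtTh2009, Def 3.3 p.73] -/
theorem pairing_add_left (κ κ' : Fin 3 → B) (f : Exp) : pairing (κ + κ') f = pairing κ f + pairing κ' f := by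
  simp only [pairing, Pi.add_apply, smul_add]
  abel

/-- The trivial class triple pairs to `0`. [cite: MochizukiEtTh2009, Def 3.3 p.73] -/
@[simp] theorem pairing_zero_left (f : Exp) : pairing (0 : Fin 3 → B) f = 0 := by
  simp [pairing]

/-- On the uniformiser root `ϖ̈_m`: `κ · e = κ_ϖ`. [cite: MochizukiEtTh2009, §1 p.13] -/
@[simp] theorem pairing_unif (κ : Fin 3 → B) : pairing κ ((0, 1, 0, 0) : Exp) = κ 0 := by simp [pairing, eC, eU, eT]
/-- On the coordinate root `Ü_m`: `κ · e = κ_U`. [cite: MochizukiEtTh2009, §1 p.13] -/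
@[simp] theorem pairing_coordU (κ : Fin 3 → B) : pairing κ ((0, 0, 1, 0) : Exp) = κ 1 := by simp [pairing, eC, eU, eT]
/-- On the theta root `Θ̈_m`: `κ · e = κ_Θ`. [cite: MochizukiEtTh2009, §1 p.13] -/
@[simp] theorem pairing_theta (κ : Fin 3 → B) : pairing κ ((0, 0, 0, 1) : Exp) = κ 2 := by simp [pairing, eC, eU, eT]

/-- The pairing along a product of functions of the skeleton. [cite: MochizukiEtTh2009, Def 3.3 p.73] -/
theorem pairing_toAdd_mul (κ : Fin 3 → B) (f g : TateTowerTheta.model.Fn) :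
    pairing κ (Multiplicative.toAdd (f * g)) = pairing κ (Multiplicative.toAdd f) + pairing κ (Multiplicative.toAdd g) :=
  pairing_add κ _ _

/-! ## The Kummer automorphisms `K_κ` of the level -/

/-- **`K_κ : (ζ, f) ↦ (ζ · ζ_m^{κ·e(f)}, f)`** — the class triple `κ` multiplying every root by a root of unity, as an automorphism of
`Fn = μ × Fn(skeleton)`. [cite: MochizukiEtTh2009, Def 3.3 p.73] -/
def kummerAut (κ : Fin 3 → B) : Fn (Multiplicative B) ≃* Fn (Multiplicative B) where
  toFun x := (x.1 * Multiplicative.ofAdd (pairing κ (Multiplicative.toAdd x.2)), x.2)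
  invFun x := (x.1 / Multiplicative.ofAdd (pairing κ (Multiplicative.toAdd x.2)), x.2)
  left_inv x := Prod.ext (mul_div_cancel_right _ _) rfl
  right_inv x := Prod.ext (div_mul_cancel _ _) rfl
  map_mul' x y := Prod.ext (show x.1 * y.1 * Multiplicative.ofAdd (pairing κ (Multiplicative.toAdd (x.2 * y.2))) =
      x.1 * Multiplicative.ofAdd (pairing κ (Multiplicative.toAdd x.2)) * (y.1 * Multiplicative.ofAdd (pairing κ (Multiplicative.toAdd y.2)))
    by rw [pairing_toAdd_mul, ofAdd_add, mul_mul_mul_comm]) rfl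

/-- `K_κ` fixes the skeleton part (hence every divisor). [cite: MochizukiEtTh2009, Def 3.3 p.73] -/
@[simp] theorem kummerAut_snd (κ : Fin 3 → B) (x : Fn (Multiplicative B)) : (kummerAut κ x).2 = x.2 := rfl

/-- `K_κ` on the root-of-unity coordinate. [cite: MochizukiEtTh2009, Def 3.3 p.73] -/
@[simp] theorem kummerAut_fst (κ : Fin 3 → B) (x : Fn (Multiplicative B)) :
    (kummerAut κ x).1 = x.1 * Multiplicative.ofAdd (pairing κ (Multiplicative.toAdd x.2)) := rfl

/-- `K_0 = id`. [cite: MochizukiEtTh2009, Def 3.3 p.73] -/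
theorem kummerAut_zero : kummerAut (0 : Fin 3 → B) = MulEquiv.refl _ :=
  MulEquiv.ext fun x => Prod.ext (by rw [kummerAut_fst, pairing_zero_left, ofAdd_zero, mul_one]; rfl) rfl

/-- `K_{κ+κ′} = K_κ ∘ K_{κ′}`. [cite: MochizukiEtTh2009, Def 3.3 p.73] -/
theorem kummerAut_add (κ κ' : Fin 3 → B) : kummerAut (κ + κ') = (kummerAut κ).trans (kummerAut κ') :=
  MulEquiv.ext fun x => Prod.ext (show x.1 * Multiplicative.ofAdd (pairing (κ + κ') (Multiplicative.toAdd x.2)) =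
      x.1 * Multiplicative.ofAdd (pairing κ (Multiplicative.toAdd x.2)) * Multiplicative.ofAdd (pairing κ' (Multiplicative.toAdd x.2))
    by rw [pairing_add_left, ofAdd_add, mul_assoc]) rfl

/-- **The Kummer action `κ ↦ K_κ`** of the (additive) group of class triples on the functions of the level — a homomorphism.
[cite: MochizukiEtTh2009, Def 3.3 p.73] -/
def kummerAction : Multiplicative (Fin 3 → B) →* MulAut (Fn (Multiplicative B)) where
  toFun κ := kummerAut (Multiplicative.toAdd κ)
  map_one' := by rw [toAdd_one, kummerAut_zero]; rfl
  map_mul' κ κ' := by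
    rw [toAdd_mul, add_comm, kummerAut_add]
    rfl

/-- `kummerAction κ = K_κ`. [cite: MochizukiEtTh2009, Def 3.3 p.73] -/
@[simp] theorem kummerAction_apply (κ : Multiplicative (Fin 3 → B)) (x : Fn (Multiplicative B)) :
    kummerAction κ x = kummerAut (Multiplicative.toAdd κ) x := rfl

/-- **On the generators**: `ϖ̈_m ↦ ζ^{κ_ϖ} ϖ̈_m`. [cite: MochizukiEtTh2009, §1 p.13] -/
theorem kummerAut_unif (κ : Fin 3 → B) : kummerAut κ (unif (Multiplicative B)) = (Multiplicative.ofAdd (κ 0), TateTowerTheta.unif) :=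
  Prod.ext (by rw [kummerAut_fst]; change 1 * Multiplicative.ofAdd (pairing κ ((0, 1, 0, 0) : Exp)) = _; rw [pairing_unif, one_mul]) rfl

/-- `Ü_m ↦ ζ^{κ_U} Ü_m`. [cite: MochizukiEtTh2009, §1 p.13] -/
theorem kummerAut_coordU (κ : Fin 3 → B) :
    kummerAut κ (coordU (Multiplicative B)) = (Multiplicative.ofAdd (κ 1), TateTowerTheta.coordU) :=
  Prod.ext (by rw [kummerAut_fst]; change 1 * Multiplicative.ofAdd (pairing κ ((0, 0, 1, 0) : Exp)) = _; rw [pairing_coordU, one_mul])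
    rfl

/-- `Θ̈_m ↦ ζ^{κ_Θ} Θ̈_m` — the THETA class acts (the third Kummer coordinate of «GRP₃»). [cite: MochizukiEtTh2009, Prop 1.4 p.21] -/
theorem kummerAut_theta (κ : Fin 3 → B) : kummerAut κ (theta (Multiplicative B)) = (Multiplicative.ofAdd (κ 2), TateTowerTheta.theta) :=
  Prod.ext (by rw [kummerAut_fst]; change 1 * Multiplicative.ofAdd (pairing κ ((0, 0, 0, 1) : Exp)) = _; rw [pairing_theta, one_mul])
    rfl

/-- Roots of unity are fixed. [cite: MochizukiEtTh2009, §1 p.13] -/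
theorem kummerAut_zeta (κ : Fin 3 → B) (ζ : Multiplicative B) : kummerAut κ (zeta (Multiplicative B) ζ) = zeta (Multiplicative B) ζ :=
  Prod.ext (by rw [kummerAut_fst]; change ζ * Multiplicative.ofAdd (pairing κ (0 : Exp)) = ζ; rw [pairing_zero, ofAdd_zero, mul_one]) rfl

/-! ## `K_κ` preserves every structure of the level: a `GaloisAction` with trivial action on log-divisors -/

variable [Finite B]

/-- **The Kummer action is STRUCTURE-PRESERVING**: a `GaloisAction` of the group of class triples on the level
`TateTowerThetaTwist.model μ`, trivial on log-divisors, cusps and components (it moves no divisor: only roots of unity are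
multiplied in), every law PROVED. [cite: MochizukiEtTh2009, Def 3.3 p.73] -/
def kummerGaloisAction : (model (Multiplicative B)).GaloisAction (Multiplicative (Fin 3 → B)) where
  actFn := kummerAction
  actDIV := 1
  permCusp := 1
  permComp := 1
  act_mem_DIVplus _ _ h := h
  act_mem_Div _ _ h := h
  act_mem_logMero _ _ _ := trivial
  act_mem_const _ _ h := h
  act_mem_intConst _ _ h := h
  divisor_act _ _ := rfl
  mult_act _ d x := by cases x <;> rfl

/-- The Kummer action does not move log-divisors. [cite: MochizukiEtTh2009, Def 3.3 p.73] -/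
theorem kummerGaloisAction_actDIV (κ : Multiplicative (Fin 3 → B)) (d : (model (Multiplicative B)).DIV) :
    (kummerGaloisAction (B := B)).actDIV κ d = d := rfl

/-- The Kummer action on functions is `K_κ`. [cite: MochizukiEtTh2009, Def 3.3 p.73] -/
theorem kummerGaloisAction_actFn (κ : Multiplicative (Fin 3 → B)) (x : Fn (Multiplicative B)) :
    (kummerGaloisAction (B := B)).actFn κ x = kummerAut (Multiplicative.toAdd κ) x := rfl

/-- The divisor of `K_κ f` is the divisor of `f`. [cite: MochizukiEtTh2009, Def 3.3 p.73] -/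
theorem divisor_kummerAut (κ : Fin 3 → B) (f : (model (Multiplicative B)).logMero) :
    (model (Multiplicative B)).divisor ⟨kummerAut κ f.1, Subgroup.mem_top _⟩ = (model (Multiplicative B)).divisor f := rfl

omit [Finite B] in
/-- `K_κ` is the identity iff `κ` pairs trivially with every root exponent — in particular `K_κ ≠ id` as soon as some `κ_i ≠ 0`
(test on the generators). [cite: MochizukiEtTh2009, §1 p.13] -/
theorem kummerAut_eq_refl_iff (κ : Fin 3 → B) : kummerAut κ = MulEquiv.refl _ ↔ κ = 0 := by
  constructor
  · intro h
    have h0 := congrArg (fun e => (e (unif (Multiplicative B))).1) h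
    have h1 := congrArg (fun e => (e (coordU (Multiplicative B))).1) h
    have h2 := congrArg (fun e => (e (theta (Multiplicative B))).1) h
    simp only [kummerAut_unif, kummerAut_coordU, kummerAut_theta, MulEquiv.refl_apply] at h0 h1 h2
    change Multiplicative.ofAdd (κ 0) = 1 at h0
    change Multiplicative.ofAdd (κ 1) = 1 at h1
    change Multiplicative.ofAdd (κ 2) = 1 at h2
    funext i
    fin_cases i
    · exact ofAdd_eq_one.mp h0
    · exact ofAdd_eq_one.mp h1
    · exact ofAdd_eq_one.mp h2
  · rintro rfl
    exact kummerAut_zero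

/-! ## (3) Level transitions and their compatibility with the Kummer action -/

omit [Finite B]

variable {B' : Type} [AddCommGroup B']

/-- The exponent map of the level transition with ramification `e`: `(ε, c, k, t) ↦ (ε, e c, e k, e t)` (`ϖ̈_m = ϖ̈_{m′}^e`, …; the
sign is kept). [cite: MochizukiEtTh2009, Def 3.3 (iii) p.74] -/
def resExp (e : ℕ) : Exp →+ Exp where
  toFun f := (f.1, (e : ℤ) * eC f, (e : ℤ) * eU f, (e : ℤ) * eT f)
  map_zero' := ext_exp rfl (by simp [eC]) (by simp [eU]) (by simp [eT])
  map_add' f g := ext_exp rfl (by simp only [eC, Prod.snd_add, Prod.fst_add]; ring)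
    (by simp only [eU, Prod.snd_add, Prod.fst_add]; ring) (by simp only [eT, Prod.snd_add]; ring)

/-- `eC (resExp e f) = e · eC f`. [cite: MochizukiEtTh2009, Def 3.3 (iii) p.74] -/
@[simp] theorem eC_resExp (e : ℕ) (f : Exp) : eC (resExp e f) = e * eC f := rfl
/-- `eU (resExp e f) = e · eU f`. [cite: MochizukiEtTh2009, Def 3.3 (iii) p.74] -/
@[simp] theorem eU_resExp (e : ℕ) (f : Exp) : eU (resExp e f) = e * eU f := rfl
/-- `eT (resExp e f) = e · eT f`. [cite: MochizukiEtTh2009, Def 3.3 (iii) p.74] -/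
@[simp] theorem eT_resExp (e : ℕ) (f : Exp) : eT (resExp e f) = e * eT f := rfl

/-- `resExp` along a product of functions of the skeleton. [cite: MochizukiEtTh2009, Def 3.3 (iii) p.74] -/
theorem resExp_toAdd_mul (e : ℕ) (f g : TateTowerTheta.model.Fn) :
    resExp e (Multiplicative.toAdd (f * g)) = resExp e (Multiplicative.toAdd f) + resExp e (Multiplicative.toAdd g) :=
  map_add _ _ _

/-- **Divisors scale by the ramification index along the transition**: `div(res f) = e · div(f)` at every prime log-divisor.
[cite: MochizukiEtTh2009, Def 3.3 (iii) p.74] -/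
theorem divFun_resExp (e : ℕ) (f : Exp) (x : TateTowerTheta.Idx) : divFun (resExp e f) x = e * divFun f x := by
  rcases x with c | j
  · rw [divFun_inl, divFun_inl, eT_resExp]
  · rw [divFun_inr, divFun_inr, eC_resExp, eU_resExp, eT_resExp]; ring

/-- The pairing along the transition: `κ′ · e(res f) = e · (κ′ · e(f))`… read through `ι`: if `ι(κ_i) = e • κ′_i` then
`ι(κ · e(f)) = κ′ · e(res_e f)`. [cite: MochizukiEtTh2009, Def 3.3 (iii) p.74] -/
theorem map_pairing_of_compat (ι : B →+ B') (e : ℕ) {κ : Fin 3 → B} {κ' : Fin 3 → B'} (hκ : ∀ i, ι (κ i) = (e : ℤ) • κ' i)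
    (f : Exp) : ι (pairing κ f) = pairing κ' (resExp e f) := by
  simp only [pairing, map_add, map_zsmul, hκ, eC_resExp, eU_resExp, eT_resExp, smul_smul, mul_comm _ (e : ℤ)]

/-- **The level transition on functions** along an inclusion of roots of unity `ι : μ → μ′` with ramification `e`:
`(ζ, ϖ̈_m^c Ü_m^k Θ̈_m^t) ↦ (ι ζ, ϖ̈_{m′}^{ec} Ü_{m′}^{ek} Θ̈_{m′}^{et})`. [cite: MochizukiEtTh2009, Def 3.3 (iii) p.74] -/
def resFn (ι : B →+ B') (e : ℕ) : Fn (Multiplicative B) →* Fn (Multiplicative B') where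
  toFun x := (Multiplicative.ofAdd (ι (Multiplicative.toAdd x.1)), Multiplicative.ofAdd (resExp e (Multiplicative.toAdd x.2)))
  map_one' := Prod.ext (show Multiplicative.ofAdd (ι 0) = 1 by rw [map_zero]; rfl)
    (show Multiplicative.ofAdd (resExp e 0) = 1 by rw [map_zero]; rfl)
  map_mul' x y := Prod.ext
    (show Multiplicative.ofAdd (ι (Multiplicative.toAdd (x.1 * y.1))) =
        Multiplicative.ofAdd (ι (Multiplicative.toAdd x.1)) * Multiplicative.ofAdd (ι (Multiplicative.toAdd y.1)) by
      rw [toAdd_mul, map_add, ofAdd_add])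
    (show Multiplicative.ofAdd (resExp e (Multiplicative.toAdd (x.2 * y.2))) =
        Multiplicative.ofAdd (resExp e (Multiplicative.toAdd x.2)) * Multiplicative.ofAdd (resExp e (Multiplicative.toAdd y.2)) by
      rw [resExp_toAdd_mul, ofAdd_add])

/-- `resFn` on components. [cite: MochizukiEtTh2009, Def 3.3 (iii) p.74] -/
@[simp] theorem resFn_apply (ι : B →+ B') (e : ℕ) (x : Fn (Multiplicative B)) :
    resFn ι e x = (Multiplicative.ofAdd (ι (Multiplicative.toAdd x.1)),
      Multiplicative.ofAdd (resExp e (Multiplicative.toAdd x.2))) := rfl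

/-- The transition is injective when `ι` is and `e ≠ 0`. [cite: MochizukiEtTh2009, Def 3.3 (iii) p.74] -/
theorem resFn_injective (ι : B →+ B') (hι : Function.Injective ι) {e : ℕ} (he : e ≠ 0) : Function.Injective (resFn ι e) := by
  intro x y h
  have h1 := congrArg Prod.fst h
  have h2 := congrArg Prod.snd h
  simp only [resFn_apply] at h1 h2
  have he' : (e : ℤ) ≠ 0 := by exact_mod_cast he
  have h2' : resExp e (Multiplicative.toAdd x.2) = resExp e (Multiplicative.toAdd y.2) := Multiplicative.ofAdd.injective h2
  refine Prod.ext (Multiplicative.toAdd.injective (hι (Multiplicative.ofAdd.injective h1)))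
    (Multiplicative.toAdd.injective (ext_exp ?_ ?_ ?_ ?_))
  · have h3 := congrArg Prod.fst h2'; exact h3
  · have h3 := congrArg eC h2'; rw [eC_resExp, eC_resExp] at h3; exact mul_left_cancel₀ he' h3
  · have h3 := congrArg eU h2'; rw [eU_resExp, eU_resExp] at h3; exact mul_left_cancel₀ he' h3
  · have h3 := congrArg eT h2'; rw [eT_resExp, eT_resExp] at h3; exact mul_left_cancel₀ he' h3

/-- **(3) RES-COMPATIBILITY of the Kummer action**: along the transition `μ_m ⊂ μ_{m′}`, `res ∘ K_κ = K_{κ′} ∘ res` whenever the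
level-`m` classes are the restrictions of the level-`m′` classes (`ι(κ_i) = e • κ′_i`, i.e. `ζ_m^{κ_i} = (ζ_{m′}^{κ′_i})^{e}`…
read in `μ_{m′}`). [cite: MochizukiEtTh2009, Def 3.3 (iii) p.74] -/
theorem resFn_kummerAut (ι : B →+ B') (e : ℕ) {κ : Fin 3 → B} {κ' : Fin 3 → B'} (hκ : ∀ i, ι (κ i) = (e : ℤ) • κ' i)
    (x : Fn (Multiplicative B)) : resFn ι e (kummerAut κ x) = kummerAut κ' (resFn ι e x) := by
  refine Prod.ext ?_ rfl
  rw [resFn_apply, kummerAut_fst, kummerAut_fst, resFn_apply]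
  change Multiplicative.ofAdd (ι (Multiplicative.toAdd x.1 + pairing κ (Multiplicative.toAdd x.2))) =
    Multiplicative.ofAdd (ι (Multiplicative.toAdd x.1)) * Multiplicative.ofAdd (pairing κ' (resExp e (Multiplicative.toAdd x.2)))
  rw [map_add, map_pairing_of_compat ι e hκ, ofAdd_add]

/-- The transition scales divisors by `e` (the `divisor_resFn` law of a `LogDivisorTower` at these levels, on multiplicities).
[cite: MochizukiEtTh2009, Def 3.3 (iii) p.74] -/
theorem toAdd_divisor_resFn [Finite B] [Finite B'] (ι : B →+ B') (e : ℕ) (f : (model (Multiplicative B)).logMero)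
    (x : TateTowerTheta.Idx) :
    Multiplicative.toAdd ((model (Multiplicative B')).divisor ⟨resFn ι e f.1, Subgroup.mem_top _⟩) x =
      e * Multiplicative.toAdd ((model (Multiplicative B)).divisor f) x := by
  rw [toAdd_divisor, toAdd_divisor]
  change divFun (resExp e (Multiplicative.toAdd f.1.2)) x = _
  exact divFun_resExp e _ x

end TateTowerThetaTwist

end LogDivisorModel

end Literature.AnabelianGeometry.EtaleTheta

end
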